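import Literature.Computability.Learning.GLStageFP
import Literature.Computability.Complexity.StringEquality
import Literature.Computability.Complexity.IndexAllBricks
import HarnessLib

/-!
# The direct-product decoder of the hypothesis in `FP`

Machine-layer instalment (M6) of the decomposition of the named fact
`Literature.Computability.Learning.cikk_natural_implies_learning` (CIKK 2016, Thm. 5.1): the
IJKW decoder `DirectProduct.decode` (`DirectProductDecoding.lean`; CIKK Thm. 4.1) with its
sampling steps fixed, as string functions, for an arbitrary direct-product oracle given as a
string function `cand` with `cand ⟨G, tupleBits x⃗⟩ = List.ofFn (C' x⃗)` (the learner uses the GL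
stage `candVecFn pred`). On `⟨D, xbits⟩`,
`D = ⟨G, ⟨⟨1ⁿ, ⟨1ᵏ, 1ᵗ⟩⟩, ⟨Pb, ⟨abits, ⟨vbits, steps⟩⟩⟩⟩⟩` (trusted-position bits, trusted
tuple, trusted values, and the list code of the `t` steps `⟨1ʲ, tupleBits y⟩`):

* `stepTupleFn` (the queried tuple `fill P a (update y j x)` as `kn` bits), `consFn` (the
  consistency bit `∀ c ∈ P, C'(B')_c = v_c`), `stepOutFn` (`[C'(B')_j]` if the step answers,
  `ε` otherwise), `decodeFn` (the first answer, default `false`);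
* bridge `decodeFn_apply`: the value is `[decode C' (posSet Pb) a v false steps x]`.

## References

* R. Impagliazzo, R. Jaiswal, V. Kabanets, A. Wigderson, *Uniform direct product theorems*,
  SIAM J. Comput. 39 (2010), Algorithm 1 [ImpagliazzoEtAl2010].
* M. Carmosino, R. Impagliazzo, V. Kabanets, A. Kolokolova, *Learning algorithms from natural
  proofs*, CCC 2016, Thm. 4.1 [CarmosinoImpagliazzoKabanetsKolokolova2016].
-/

open Polynomial

namespace Literature.Computability.Learning

open Literature.Computability.Complexity Literature.Computability.Complexity.Brick
  Literature.Computability.Complexity.Plumb Literature.Computability.Complexity.DirectProduct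
  Literature.Computability.MetaComplexity Literature.Computability.Cryptography _root_.Computability Finset

variable {n k : ℕ}

/-! ### The queried tuple of a step -/

/-- Block `c` of `tupleBits`. [folklore] -/
theorem drop_take_tupleBits (xs : Fin k → (Fin n → Bool)) (c : Fin k) :
    ((tupleBits xs).drop (c * n)).take n = List.ofFn (xs c) := by
  apply List.ext_getElem
  · simp only [List.length_take, List.length_drop, tupleBits, List.length_ofFn]
    have h1 : (c : ℕ) + 1 ≤ k := c.isLt
    have : (c + 1) * n ≤ k * n := Nat.mul_le_mul_right n h1
    rw [add_mul, one_mul] at this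
    omega
  · intro d h1 h2
    rw [List.length_ofFn] at h2
    simp only [tupleBits, List.getElem_take, List.getElem_drop, List.getElem_ofFn]
    have hidx : (finProdFinEquiv.symm (⟨c * n + d, by
        have h1 : (c : ℕ) + 1 ≤ k := c.isLt
        have : (c + 1) * n ≤ k * n := Nat.mul_le_mul_right n h1
        rw [add_mul, one_mul] at this; omega⟩ : Fin (k * n))) = (c, ⟨d, h2⟩) := by
      rw [Equiv.symm_apply_eq]
      apply Fin.ext
      simp [finProdFinEquiv]
      ring
    rw [hidx]

/-- The step-tuple context `⟨⟨1ⁿ, 1ᵏ⟩, ⟨Pb, ⟨abits, ⟨xbits, ⟨1ʲ, ybits⟩⟩⟩⟩⟩`. [folklore] -/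
def stepCtx (n k : ℕ) (Pb abits xbits : List Bool) (j : ℕ) (ybits : List Bool) : List Bool :=
  boolPair (boolPair (ones n) (ones k)) (boolPair Pb (boolPair abits (boolPair xbits (boolPair (ones j) ybits))))

/-- The piece of the step-tuple fold at block `c`: `a_c` if `c ∈ P`, else `x` if `c = j`, else `y_c`.
[cite: ImpagliazzoEtAl2010, Algorithm 1] -/
noncomputable def stepTuplePiece : List Bool → List Bool :=
  iteFn (HashBricks.headBitFn ∘ bitAtFn ∘ fanoutFn sndF (nthF 0 ∘ sndF ∘ fstF))
    (blockFn ∘ fanoutFn (fanoutFn (fstF ∘ fstF ∘ fstF) sndF) (nthF 1 ∘ sndF ∘ fstF))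
    (iteFn (andFn (notFn (ltLenF ∘ fanoutFn sndF (nthF 3 ∘ sndF ∘ fstF)))
        (notFn (ltLenF ∘ fanoutFn (nthF 3 ∘ sndF ∘ fstF) sndF)))
      (nthF 2 ∘ sndF ∘ fstF)
      (blockFn ∘ fanoutFn (fanoutFn (fstF ∘ fstF ∘ fstF) sndF) (sndPow 3 ∘ sndF ∘ fstF)))

/-- `stepTuplePiece ∈ FP`. [folklore] -/
theorem stepTuplePiece_mem_FP : stepTuplePiece ∈ FP := by
  have hsf : (sndF ∘ fstF : List Bool → List Bool) ∈ FP := comp_mem_FP sndF_mem_FP fstF_mem_FP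
  have h3 : (nthF 3 ∘ sndF ∘ fstF : List Bool → List Bool) ∈ FP := comp_mem_FP (nthF_mem_FP 3) hsf
  have hfff : (fstF ∘ fstF ∘ fstF : List Bool → List Bool) ∈ FP := comp_mem_FP fstF_mem_FP (comp_mem_FP fstF_mem_FP fstF_mem_FP)
  exact iteFn_mem_FP (comp_mem_FP HashBricks.headBitFn_mem_FP (comp_mem_FP bitAtFn_mem_FP
      (fanoutFn_mem_FP sndF_mem_FP (comp_mem_FP (nthF_mem_FP 0) hsf))))
    (comp_mem_FP blockFn_mem_FP (fanoutFn_mem_FP (fanoutFn_mem_FP hfff sndF_mem_FP) (comp_mem_FP (nthF_mem_FP 1) hsf)))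
    (iteFn_mem_FP (andFn_mem_FP (notFn_mem_FP (comp_mem_FP ltLenF_mem_FP (fanoutFn_mem_FP sndF_mem_FP h3)))
        (notFn_mem_FP (comp_mem_FP ltLenF_mem_FP (fanoutFn_mem_FP h3 sndF_mem_FP))))
      (comp_mem_FP (nthF_mem_FP 2) hsf)
      (comp_mem_FP blockFn_mem_FP (fanoutFn_mem_FP (fanoutFn_mem_FP hfff sndF_mem_FP) (comp_mem_FP (sndPow_mem_FP 3) hsf))))

/-- Value of `stepTuplePiece`. [folklore] -/
theorem stepTuplePiece_apply (n k : ℕ) (Pb abits xbits : List Bool) (j : ℕ) (ybits : List Bool) (c : ℕ) :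
    stepTuplePiece (boolPair (stepCtx n k Pb abits xbits j ybits) (ones c)) =
      if (Pb.drop c).headD false then (abits.drop (c * n)).take n
      else if c = j then xbits else (ybits.drop (c * n)).take n := by
  rw [stepTuplePiece, iteFn_apply (b := (Pb.drop c).headD false) (by
    simp only [Function.comp_apply, fanoutFn_apply, sndF_boolPair, fstF_boolPair, stepCtx, nthF, bitAtFn_boolPair,
      HashBricks.headBitFn_apply, List.length_replicate, ones]
    cases Pb.drop c <;> simp)]
  split_ifs with h1 h2
  · simp [stepCtx, nthF, ones]
  · subst h2
    rw [iteFn_apply (b := true) (by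
      rw [andFn_apply (b := true) (b' := true)] <;>
        simp [notFn_apply, stepCtx, nthF, ltLenF_boolPair, ones])]
    simp [stepCtx, nthF]
  · rw [iteFn_apply (b := false) (by
      rcases Nat.lt_or_gt_of_ne h2 with h | h
      · rw [andFn_apply (b := false) (b' := true)] <;> simp [notFn_apply, stepCtx, nthF, ltLenF_boolPair, ones, h, not_lt.2 h.le]
      · rw [andFn_apply (b := true) (b' := false)] <;> simp [notFn_apply, stepCtx, nthF, ltLenF_boolPair, ones, h, not_lt.2 h.le])]
    simp [stepCtx, sndPow, ones]

/-- The step-tuple pieces have length `≤ max n |xbits| ≤ |context|`. [folklore] -/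
theorem length_stepTuplePiece_apply_le (n k : ℕ) (Pb abits xbits : List Bool) (j : ℕ) (ybits : List Bool) (c : ℕ) :
    (stepTuplePiece (boolPair (stepCtx n k Pb abits xbits j ybits) (ones c))).length ≤
      1 * ((stepCtx n k Pb abits xbits j ybits).length + 1) := by
  rw [stepTuplePiece_apply]
  have h : n ≤ (stepCtx n k Pb abits xbits j ybits).length ∧ xbits.length ≤ (stepCtx n k Pb abits xbits j ybits).length := by
    simp only [stepCtx, length_boolPair, ones, List.length_replicate]; omega
  split_ifs
  · exact (List.length_take_le _ _).trans (by omega)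
  · omega
  · exact (List.length_take_le _ _).trans (by omega)

/-- **The queried tuple** `fill P a (update y j x)` as `kn` bits, on the step context.
[cite: ImpagliazzoEtAl2010, Algorithm 1] -/
noncomputable def stepTupleFn : List Bool → List Bool :=
  sndPow 2 ∘ foldLoop appF (clipF 1 stepTuplePiece) X ∘
    fanoutFn id (fanoutFn (lenBinF ∘ sndF ∘ fstF) (fun _ => boolPair [] []))

/-- `stepTupleFn ∈ FP`. [folklore] -/
theorem stepTupleFn_mem_FP : stepTupleFn ∈ FP :=
  comp_mem_FP (sndPow_mem_FP 2) (comp_mem_FP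
    (foldLoop_clipF_mem_FP 1 appF_mem_FP length_appF_le stepTuplePiece_mem_FP X)
    (fanoutFn_mem_FP (PolyTimeComputable.id _)
      (fanoutFn_mem_FP (comp_mem_FP lenBinF_mem_FP (comp_mem_FP sndF_mem_FP fstF_mem_FP)) (const_mem_FP _))))

/-- Value of `stepTupleFn` (string level). [folklore] -/
theorem stepTupleFn_apply_str (n k : ℕ) (Pb abits xbits : List Bool) (j : ℕ) (ybits : List Bool) :
    stepTupleFn (stepCtx n k Pb abits xbits j ybits) =
      ccat (fun c => stepTuplePiece (boolPair (stepCtx n k Pb abits xbits j ybits) (ones c))) k := by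
  have hk : k ≤ X.eval (stepCtx n k Pb abits xbits j ybits).length := by
    rw [eval_X]; simp only [stepCtx, length_boolPair, ones, List.length_replicate]; omega
  have h1 : lenBinF (sndF (fstF (stepCtx n k Pb abits xbits j ybits))) = encodeNat k := by simp [stepCtx, ones]
  rw [stepTupleFn, Function.comp_apply, Function.comp_apply, fanoutFn_apply, fanoutFn_apply, id,
    Function.comp_apply, Function.comp_apply, h1,
    show (boolPair ([] : List Bool) []) = boolPair (ones 0) ([] : List Bool) by rfl,
    foldLoop_apply _ _ hk, foldAcc_clipF (fun c _ _ => length_stepTuplePiece_apply_le n k Pb abits xbits j ybits c),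
    foldAcc_appF]
  simp [sndPow]

/-- A tuple string is the concatenation of its blocks. [folklore] -/
theorem tupleBits_eq_ccat (xs : Fin k → (Fin n → Bool)) :
    tupleBits xs = ccat (fun c => if h : c < k then List.ofFn (xs ⟨c, h⟩) else []) k := by
  have key : ∀ m (hm : m ≤ k), (tupleBits xs).take (m * n) = ccat (fun c => if h : c < k then List.ofFn (xs ⟨c, h⟩) else []) m := by
    intro m hm
    induction m with
    | zero => simp
    | succ m ih =>
      rw [ccat_succ, ← ih (by omega), dif_pos (by omega : m < k), ← drop_take_tupleBits xs ⟨m, by omega⟩,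
        Nat.succ_mul, ← List.take_add]
  have := key k le_rfl
  rwa [List.take_of_length_le (by simp [tupleBits])] at this

/-- **Value of `stepTupleFn`** on genuine data: the bits of `stepTuple (posSet Pb) a x (j, y)`.
[cite: ImpagliazzoEtAl2010, Algorithm 1] -/
theorem stepTupleFn_apply (Pb : Fin k → Bool) (a : Fin k → (Fin n → Bool)) (x : Fin n → Bool) (j : Fin k)
    (y : Fin k → (Fin n → Bool)) :
    stepTupleFn (stepCtx n k (List.ofFn Pb) (tupleBits a) (List.ofFn x) j (tupleBits y)) =
      tupleBits (stepTuple (posSet Pb) a x (j, y)) := by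
  rw [stepTupleFn_apply_str]
  conv_rhs => rw [tupleBits_eq_ccat]
  refine ccat_congr fun c hc => ?_
  rw [stepTuplePiece_apply, dif_pos hc, headD_drop_ofFn Pb hc,
    show c * n = ((⟨c, hc⟩ : Fin k) : ℕ) * n from rfl, drop_take_tupleBits a ⟨c, hc⟩, drop_take_tupleBits y ⟨c, hc⟩]
  have hmem : (⟨c, hc⟩ : Fin k) ∈ posSet Pb ↔ Pb ⟨c, hc⟩ = true := by simp [posSet]
  simp only [stepTuple, fill, Function.update_apply, Fin.ext_iff]
  by_cases hP : Pb ⟨c, hc⟩ = true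
  · rw [if_pos hP, if_pos (hmem.2 hP)]
  · rw [if_neg hP, if_neg (fun h => hP (hmem.1 h))]
    split_ifs <;> rfl

/-! ### Consistency with the trusted values -/

/-- The piece of the consistency fold on `⟨⟨Pb, ⟨cand, vbits⟩⟩, 1ᶜ⟩`: `[c ∈ P → cand_c = v_c]`. [folklore] -/
noncomputable def consPiece : List Bool → List Bool :=
  orFn (notFn (HashBricks.headBitFn ∘ bitAtFn ∘ fanoutFn sndF (fstF ∘ fstF)))
    (notFn (HashBricks.xorFn (HashBricks.headBitFn ∘ bitAtFn ∘ fanoutFn sndF (nthF 1 ∘ fstF))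
      (HashBricks.headBitFn ∘ bitAtFn ∘ fanoutFn sndF (sndPow 1 ∘ fstF))))

/-- `consPiece ∈ FP`. [folklore] -/
theorem consPiece_mem_FP : consPiece ∈ FP :=
  orFn_mem_FP (notFn_mem_FP (comp_mem_FP HashBricks.headBitFn_mem_FP (comp_mem_FP bitAtFn_mem_FP
      (fanoutFn_mem_FP sndF_mem_FP (comp_mem_FP fstF_mem_FP fstF_mem_FP)))))
    (notFn_mem_FP (HashBricks.xorFn_mem_FP
      (comp_mem_FP HashBricks.headBitFn_mem_FP (comp_mem_FP bitAtFn_mem_FP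
        (fanoutFn_mem_FP sndF_mem_FP (comp_mem_FP (nthF_mem_FP 1) fstF_mem_FP))))
      (comp_mem_FP HashBricks.headBitFn_mem_FP (comp_mem_FP bitAtFn_mem_FP
        (fanoutFn_mem_FP sndF_mem_FP (comp_mem_FP (sndPow_mem_FP 1) fstF_mem_FP))))))

/-- `consPiece` is one-bit. [folklore] -/
theorem oneBit_consPiece : OneBit consPiece :=
  oneBit_orFn (oneBit_notFn (HashBricks.oneBit_headBitFn.comp _))
    (oneBit_notFn (HashBricks.oneBit_xorFn (HashBricks.oneBit_headBitFn.comp _) (HashBricks.oneBit_headBitFn.comp _)))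

/-- Value of `consPiece` on genuine vectors. [folklore] -/
theorem consPiece_apply (Pb cand v : Fin k → Bool) {c : ℕ} (hc : c < k) :
    consPiece (boolPair (boolPair (List.ofFn Pb) (boolPair (List.ofFn cand) (List.ofFn v))) (ones c)) =
      [!(Pb ⟨c, hc⟩) || (cand ⟨c, hc⟩ == v ⟨c, hc⟩)] := by
  have hbit : ∀ u : Fin k → Bool, (HashBricks.headBitFn (bitAtFn (boolPair (ones c) (List.ofFn u)))) = [u ⟨c, hc⟩] := by
    intro u
    rw [bitAtFn_boolPair, HashBricks.headBitFn_apply, show (ones c).length = c by simp [ones], take_one_drop_ofFn u hc]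
    rfl
  rw [consPiece, orFn_apply (b := !(Pb ⟨c, hc⟩)) (b' := (cand ⟨c, hc⟩ == v ⟨c, hc⟩))]
  · rw [notFn_apply (b := Pb ⟨c, hc⟩)]
    simp only [Function.comp_apply, fanoutFn_apply, sndF_boolPair, fstF_boolPair, hbit]
  · rw [notFn_apply (b := xor (cand ⟨c, hc⟩) (v ⟨c, hc⟩))]
    · cases cand ⟨c, hc⟩ <;> cases v ⟨c, hc⟩ <;> rfl
    · rw [HashBricks.xorFn_apply (b := cand ⟨c, hc⟩) (b' := v ⟨c, hc⟩)] <;>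
        simp only [Function.comp_apply, fanoutFn_apply, sndF_boolPair, fstF_boolPair, nthF, sndPow, hbit]

/-- **The consistency bit** `[∀ c ∈ P, cand_c = v_c]` on `⟨⟨1ᵏ, Pb⟩, ⟨cand, vbits⟩⟩`.
[cite: ImpagliazzoEtAl2010, Algorithm 1 ("if the answer is consistent with v on A")] -/
noncomputable def consFn : List Bool → List Bool :=
  sndPow 2 ∘ foldLoop Brick.andOp (clipF 1 consPiece) X ∘
    fanoutFn (fanoutFn (sndF ∘ fstF) sndF) (fanoutFn (lenBinF ∘ fstF ∘ fstF) (fun _ => boolPair [] [true]))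

/-- `consFn ∈ FP`. [folklore] -/
theorem consFn_mem_FP : consFn ∈ FP :=
  comp_mem_FP (sndPow_mem_FP 2) (comp_mem_FP
    (foldLoop_clipF_mem_FP (d := 1) 1 Brick.andOp_mem_FP Brick.length_andOp_le consPiece_mem_FP X)
    (fanoutFn_mem_FP (fanoutFn_mem_FP (comp_mem_FP sndF_mem_FP fstF_mem_FP) sndF_mem_FP)
      (fanoutFn_mem_FP (comp_mem_FP lenBinF_mem_FP (comp_mem_FP fstF_mem_FP fstF_mem_FP)) (const_mem_FP _))))

/-- **Value of `consFn`** on genuine vectors. [folklore] -/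
theorem consFn_apply (Pb cand v : Fin k → Bool) :
    consFn (boolPair (boolPair (ones k) (List.ofFn Pb)) (boolPair (List.ofFn cand) (List.ofFn v))) =
      [decide (∀ c : Fin k, Pb c = true → cand c = v c)] := by
  have hk : k ≤ X.eval (boolPair (List.ofFn Pb) (boolPair (List.ofFn cand) (List.ofFn v))).length := by
    rw [eval_X]; simp only [length_boolPair, List.length_ofFn]; omega
  rw [consFn, Function.comp_apply, Function.comp_apply, fanoutFn_apply, fanoutFn_apply, fanoutFn_apply]
  simp only [Function.comp_apply, fstF_boolPair, sndF_boolPair, lenBinF_apply]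
  rw [show (ones k).length = k by simp [ones], show (boolPair ([] : List Bool) [true]) = boolPair (ones 0) [true] by rfl,
    foldLoop_apply _ _ hk, foldAcc_clipF (fun c _ _ => by rw [oneBit_consPiece.length_eq]; omega),
    Brick.foldAcc_andOp oneBit_consPiece]
  simp only [sndPow, Function.comp_apply, sndF_boolPair, Bool.true_and, zero_add]
  congr 1
  apply decide_eq_decide.2
  constructor
  · intro h c hP
    have := h c c.isLt
    rw [consPiece_apply Pb cand v c.isLt] at this
    simp only [Fin.eta, List.cons.injEq, and_true, Bool.or_eq_true, Bool.not_eq_true', beq_iff_eq] at this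
    rcases this with h' | h'
    · rw [hP] at h'; exact absurd h' (by simp)
    · exact h'
  · intro h c hc
    rw [consPiece_apply Pb cand v hc]
    simp only [List.cons.injEq, and_true, Bool.or_eq_true, Bool.not_eq_true', beq_iff_eq]
    by_cases hP : Pb ⟨c, hc⟩ = true
    · exact Or.inr (h _ hP)
    · exact Or.inl (by simpa using hP)

/-! ### Steps and the decoder -/

/-- The DP record `D = ⟨G, ⟨⟨1ⁿ, ⟨1ᵏ, 1ᵗ⟩⟩, ⟨Pb, ⟨abits, ⟨vbits, steps⟩⟩⟩⟩⟩`. [folklore] -/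
def dpRec (G : List Bool) (n k t : ℕ) (Pb abits vbits stepsCode : List Bool) : List Bool :=
  boolPair G (boolPair (boolPair (ones n) (boolPair (ones k) (ones t))) (boolPair Pb (boolPair abits (boolPair vbits stepsCode))))

/-- The list code of the steps `(j_r, y_r)`, `r < t`, each as `⟨1^{j_r}, tupleBits y_r⟩`. [folklore] -/
def stepsCode {t : ℕ} (steps : Fin t → Fin k × (Fin k → (Fin n → Bool))) : List Bool :=
  OracleCompose.body (List.ofFn fun r => boolPair (ones (steps r).1) (tupleBits (steps r).2))

section StepAccessors
/-- Accessor on the step argument `w = ⟨⟨D, xbits⟩, 1ʳ⟩`: `D`. [folklore] -/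
noncomputable def sD : List Bool → List Bool := fstF ∘ fstF
/-- Accessor: the data record `⟨Pb, ⟨abits, ⟨vbits, steps⟩⟩⟩`. [folklore] -/
noncomputable def sData : List Bool → List Bool := sndF ∘ sndF ∘ sD
/-- Accessor: the dimension record `⟨1ⁿ, ⟨1ᵏ, 1ᵗ⟩⟩`. [folklore] -/
noncomputable def sDims : List Bool → List Bool := fstF ∘ sndF ∘ sD
/-- Accessor: the step item `⟨1ʲ, ybits⟩`. [folklore] -/
noncomputable def sItem : List Bool → List Bool := HashBricks.nthItemFn ∘ fanoutFn sndF (sndPow 2 ∘ sData)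
/-- Accessor: the step context for `stepTupleFn`. [folklore] -/
noncomputable def sCtx : List Bool → List Bool :=
  fanoutFn (fanoutFn (fstF ∘ sDims) (nthF 1 ∘ sDims))
    (fanoutFn (nthF 0 ∘ sData) (fanoutFn (nthF 1 ∘ sData) (fanoutFn (sndF ∘ fstF)
      (fanoutFn (fstF ∘ sItem) (sndF ∘ sItem)))))
/-- Accessor: the candidate vector `cand ⟨G, B'⟩`. [folklore] -/
noncomputable def sCand (cand : List Bool → List Bool) : List Bool → List Bool :=
  cand ∘ fanoutFn (fstF ∘ sD) (stepTupleFn ∘ sCtx)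
/-- Accessor: the answer bit `[j ∉ P ∧ consistent]`. [folklore] -/
noncomputable def sAns (cand : List Bool → List Bool) : List Bool → List Bool :=
  andFn (notFn (HashBricks.headBitFn ∘ bitAtFn ∘ fanoutFn (fstF ∘ sItem) (nthF 0 ∘ sData)))
    (HashBricks.headBitFn ∘ consFn ∘ fanoutFn (fanoutFn (nthF 1 ∘ sDims) (nthF 0 ∘ sData))
      (fanoutFn (sCand cand) (nthF 2 ∘ sData)))

/-- The step accessors are in `FP` (given `cand ∈ FP`). [folklore] -/
theorem sAccessors_mem_FP {cand : List Bool → List Bool} (hc : cand ∈ FP) :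
    sD ∈ FP ∧ sData ∈ FP ∧ sDims ∈ FP ∧ sItem ∈ FP ∧ sCtx ∈ FP ∧ sCand cand ∈ FP ∧ sAns cand ∈ FP := by
  have hD : sD ∈ FP := comp_mem_FP fstF_mem_FP fstF_mem_FP
  have hData : sData ∈ FP := comp_mem_FP sndF_mem_FP (comp_mem_FP sndF_mem_FP hD)
  have hDims : sDims ∈ FP := comp_mem_FP fstF_mem_FP (comp_mem_FP sndF_mem_FP hD)
  have hItem : sItem ∈ FP := comp_mem_FP HashBricks.nthItemFn_mem_FP
    (fanoutFn_mem_FP sndF_mem_FP (comp_mem_FP (sndPow_mem_FP 2) hData))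
  have hCtx : sCtx ∈ FP := fanoutFn_mem_FP (fanoutFn_mem_FP (comp_mem_FP fstF_mem_FP hDims) (comp_mem_FP (nthF_mem_FP 1) hDims))
    (fanoutFn_mem_FP (comp_mem_FP (nthF_mem_FP 0) hData) (fanoutFn_mem_FP (comp_mem_FP (nthF_mem_FP 1) hData)
      (fanoutFn_mem_FP (comp_mem_FP sndF_mem_FP fstF_mem_FP)
        (fanoutFn_mem_FP (comp_mem_FP fstF_mem_FP hItem) (comp_mem_FP sndF_mem_FP hItem)))))
  have hCand : sCand cand ∈ FP := comp_mem_FP hc (fanoutFn_mem_FP (comp_mem_FP fstF_mem_FP hD) (comp_mem_FP stepTupleFn_mem_FP hCtx))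
  refine ⟨hD, hData, hDims, hItem, hCtx, hCand, ?_⟩
  exact andFn_mem_FP (notFn_mem_FP (comp_mem_FP HashBricks.headBitFn_mem_FP (comp_mem_FP bitAtFn_mem_FP
      (fanoutFn_mem_FP (comp_mem_FP fstF_mem_FP hItem) (comp_mem_FP (nthF_mem_FP 0) hData)))))
    (comp_mem_FP HashBricks.headBitFn_mem_FP (comp_mem_FP consFn_mem_FP (fanoutFn_mem_FP
      (fanoutFn_mem_FP (comp_mem_FP (nthF_mem_FP 1) hDims) (comp_mem_FP (nthF_mem_FP 0) hData))
      (fanoutFn_mem_FP hCand (comp_mem_FP (nthF_mem_FP 2) hData)))))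
end StepAccessors

/-- **The output of step `r`**: `[C'(B')_j]` if the step answers, `ε` otherwise.
[cite: ImpagliazzoEtAl2010, Algorithm 1] -/
noncomputable def stepOutFn (cand : List Bool → List Bool) : List Bool → List Bool :=
  iteFn (sAns cand) (bitAtFn ∘ fanoutFn (fstF ∘ sItem) (sCand cand)) (fun _ => [])

/-- `stepOutFn cand ∈ FP`. [folklore] -/
theorem stepOutFn_mem_FP {cand : List Bool → List Bool} (hc : cand ∈ FP) : stepOutFn cand ∈ FP := by
  obtain ⟨-, -, -, hItem, -, hCand, hAns⟩ := sAccessors_mem_FP hc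
  exact iteFn_mem_FP hAns (comp_mem_FP bitAtFn_mem_FP (fanoutFn_mem_FP (comp_mem_FP fstF_mem_FP hItem) hCand)) (const_mem_FP _)

/-- `sAns cand` is one-bit. [folklore] -/
theorem oneBit_sAns (cand : List Bool → List Bool) : OneBit (sAns cand) := fun w => by
  rw [sAns, andFn, iteFn_of_oneBit (oneBit_notFn (HashBricks.oneBit_headBitFn.comp _))]
  split_ifs
  · exact ⟨_, by rw [Function.comp_apply, HashBricks.headBitFn_apply]⟩
  · exact ⟨false, rfl⟩

/-- The step outputs are at most one bit long. [folklore] -/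
theorem length_stepOutFn_le (cand : List Bool → List Bool) (w : List Bool) : (stepOutFn cand w).length ≤ 1 := by
  rw [stepOutFn, iteFn_of_oneBit (oneBit_sAns cand)]
  split_ifs
  · rw [Function.comp_apply, fanoutFn_apply, bitAtFn_boolPair]; exact List.length_take_le _ _
  · simp

/-- **The decoder**: the first answer among the `t` steps (default `false`), on `⟨D, xbits⟩`.
[cite: ImpagliazzoEtAl2010, Algorithm 1 and Remark 3.3] -/
noncomputable def decodeFn (cand : List Bool → List Bool) : List Bool → List Bool :=
  HashBricks.headBitFn ∘ sndPow 2 ∘ foldLoop appF (clipF 1 (stepOutFn cand)) X ∘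
    fanoutFn id (fanoutFn (lenBinF ∘ sndPow 1 ∘ fstF ∘ sndF ∘ fstF) (fun _ => boolPair [] []))

/-- **`decodeFn cand ∈ FP`** for `cand ∈ FP`. [cite: CarmosinoImpagliazzoKabanetsKolokolova2016, Thm. 4.1 (running time)] -/
theorem decodeFn_mem_FP {cand : List Bool → List Bool} (hc : cand ∈ FP) : decodeFn cand ∈ FP :=
  comp_mem_FP HashBricks.headBitFn_mem_FP (comp_mem_FP (sndPow_mem_FP 2) (comp_mem_FP
    (foldLoop_clipF_mem_FP 1 appF_mem_FP length_appF_le (stepOutFn_mem_FP hc) X)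
    (fanoutFn_mem_FP (PolyTimeComputable.id _)
      (fanoutFn_mem_FP (comp_mem_FP lenBinF_mem_FP (comp_mem_FP (sndPow_mem_FP 1) (comp_mem_FP fstF_mem_FP
        (comp_mem_FP sndF_mem_FP fstF_mem_FP)))) (const_mem_FP _)))))

/-- `decodeFn cand` is one-bit. [folklore] -/
theorem oneBit_decodeFn (cand : List Bool → List Bool) : OneBit (decodeFn cand) :=
  HashBricks.oneBit_headBitFn.comp _

/-- Value of `decodeFn` (string level): the head of the concatenated step outputs. [folklore] -/
theorem decodeFn_apply_str (cand : List Bool → List Bool) (G : List Bool) (n k t : ℕ) (Pb abits vbits sc xbits : List Bool) :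
    decodeFn cand (boolPair (dpRec G n k t Pb abits vbits sc) xbits) =
      [(ccat (fun r => stepOutFn cand (boolPair (boolPair (dpRec G n k t Pb abits vbits sc) xbits) (ones r))) t).headD false] := by
  have ht : t ≤ X.eval (boolPair (dpRec G n k t Pb abits vbits sc) xbits).length := by
    rw [eval_X]; simp only [dpRec, length_boolPair, ones, List.length_replicate]; omega
  have h1 : lenBinF (sndPow 1 (fstF (sndF (fstF (boolPair (dpRec G n k t Pb abits vbits sc) xbits))))) = encodeNat t := by
    simp [dpRec, sndPow, ones]
  rw [decodeFn, Function.comp_apply, Function.comp_apply, Function.comp_apply, fanoutFn_apply, fanoutFn_apply, id,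
    Function.comp_apply, Function.comp_apply, Function.comp_apply, Function.comp_apply, h1,
    show (boolPair ([] : List Bool) []) = boolPair (ones 0) ([] : List Bool) by rfl,
    foldLoop_apply _ _ ht, foldAcc_clipF (fun r _ _ => (length_stepOutFn_le cand _).trans (by omega)), foldAcc_appF,
    HashBricks.headBitFn_apply]
  simp [sndPow]

/-! ### Bridge to `DirectProduct.decode` -/

/-- `decodeList` with default `false` is the head of the concatenated step outputs. [folklore] -/
theorem decodeList_eq_headD (C' : (Fin k → (Fin n → Bool)) → Fin k → Bool) (P : Finset (Fin k))
    (a : Fin k → (Fin n → Bool)) (v : Fin k → Bool) (x : Fin n → Bool) :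
    ∀ L : List (Fin k × (Fin k → (Fin n → Bool))), decodeList C' P a v false x L =
      ((L.map fun σ => if Answers C' P a v x σ then [C' (stepTuple P a x σ) σ.1] else []).flatten).headD false
  | [] => rfl
  | σ :: L => by
    rw [decodeList, List.map_cons, List.flatten_cons, decodeList_eq_headD C' P a v x L]
    split_ifs <;> rfl

/-- A flattened `ofFn` is a `ccat`. [folklore]
(Local copy: the same identity is `flatten_ofFn_eq_ccat'` in QuantumComplexity/BosonReductionCodes.lean
and `ccat_eq_flatten_ofFn` in Complexity/InteractiveProofsParallel.lean, both too heavy to import here.) -/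
theorem flatten_ofFn_eq_ccat : ∀ {t : ℕ} (F : Fin t → List Bool),
    (List.ofFn F).flatten = ccat (fun r => if h : r < t then F ⟨r, h⟩ else []) t
  | 0, F => by simp
  | t + 1, F => by
    rw [List.ofFn_succ', List.concat_eq_append, List.flatten_append, flatten_ofFn_eq_ccat, ccat_succ,
      dif_pos (Nat.lt_succ_self t)]
    congr 1
    · refine ccat_congr fun r hr => ?_
      rw [dif_pos hr, dif_pos (by omega)]; rfl
    · simp [Fin.last]

/-- **Value of one step of the machine decoder.** [cite: ImpagliazzoEtAl2010, Algorithm 1] -/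
theorem stepOutFn_apply {t : ℕ} (C' : (Fin k → (Fin n → Bool)) → Fin k → Bool) {cand : List Bool → List Bool} {G : List Bool}
    (hG : ∀ xs, cand (boolPair G (tupleBits xs)) = List.ofFn (C' xs)) (Pb : Fin k → Bool) (a : Fin k → (Fin n → Bool))
    (v : Fin k → Bool) (steps : Fin t → Fin k × (Fin k → (Fin n → Bool))) (x : Fin n → Bool) (r : Fin t) :
    stepOutFn cand (boolPair (boolPair (dpRec G n k t (List.ofFn Pb) (tupleBits a) (List.ofFn v) (stepsCode steps))
      (List.ofFn x)) (ones r)) =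
      if Answers C' (posSet Pb) a v x (steps r) then [C' (stepTuple (posSet Pb) a x (steps r)) (steps r).1] else [] := by
  classical
  set w := boolPair (boolPair (dpRec G n k t (List.ofFn Pb) (tupleBits a) (List.ofFn v) (stepsCode steps))
    (List.ofFn x)) (ones r) with hw
  have hD : sD w = dpRec G n k t (List.ofFn Pb) (tupleBits a) (List.ofFn v) (stepsCode steps) := by simp [sD, hw]
  have hData : sData w = boolPair (List.ofFn Pb) (boolPair (tupleBits a) (boolPair (List.ofFn v) (stepsCode steps))) := by
    simp [sData, hD, dpRec]
  have hDims : sDims w = boolPair (ones n) (boolPair (ones k) (ones t)) := by simp [sDims, hD, dpRec]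
  have hItem : sItem w = boolPair (ones (steps r).1) (tupleBits (steps r).2) := by
    rw [sItem, Function.comp_apply, fanoutFn_apply, Function.comp_apply, hData, hw, sndF_boolPair]
    simp only [sndPow, Function.comp_apply, sndF_boolPair, stepsCode, ones]
    rw [show List.replicate (r : ℕ) true = ones r from rfl, HashBricks.nthItemFn_body,
      List.getD_eq_getElem _ _ (by simp), List.getElem_ofFn]
  have hX : sndF (fstF w) = List.ofFn x := by rw [hw]; simp
  have hCtx : sCtx w = stepCtx n k (List.ofFn Pb) (tupleBits a) (List.ofFn x) (steps r).1 (tupleBits (steps r).2) := by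
    simp only [sCtx, fanoutFn_apply, Function.comp_apply, hDims, hData, hItem, hX, fstF_boolPair, sndF_boolPair, nthF,
      stepCtx]
  have hCand : sCand cand w = List.ofFn (C' (stepTuple (posSet Pb) a x (steps r))) := by
    rw [sCand, Function.comp_apply, fanoutFn_apply, Function.comp_apply, hD, Function.comp_apply, hCtx,
      show steps r = ((steps r).1, (steps r).2) from rfl, stepTupleFn_apply, dpRec, fstF_boolPair, hG]
  have hPbj : HashBricks.headBitFn (bitAtFn (boolPair (ones (steps r).1) (List.ofFn Pb))) = [Pb (steps r).1] := by
    rw [bitAtFn_boolPair, HashBricks.headBitFn_apply, show (ones ((steps r).1 : ℕ)).length = (steps r).1 by simp [ones],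
      take_one_drop_ofFn Pb (steps r).1.isLt]
    rfl
  have hAnsIff : Answers C' (posSet Pb) a v x (steps r) ↔
      (Pb (steps r).1 = false ∧ ∀ c : Fin k, Pb c = true → C' (stepTuple (posSet Pb) a x (steps r)) c = v c) := by
    simp [Answers, posSet]
  have hAns : sAns cand w = [decide (Answers C' (posSet Pb) a v x (steps r))] := by
    rw [sAns, andFn_apply (b := !(Pb (steps r).1)) (b' := decide (∀ c : Fin k, Pb c = true →
        C' (stepTuple (posSet Pb) a x (steps r)) c = v c))]
    · rw [decide_eq_decide.2 hAnsIff, Bool.decide_and]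
      cases Pb (steps r).1 <;> simp
    · rw [notFn_apply (b := Pb (steps r).1)]
      rw [Function.comp_apply, Function.comp_apply, fanoutFn_apply, Function.comp_apply, hItem, fstF_boolPair,
        Function.comp_apply, hData]
      simpa [nthF] using hPbj
    · rw [Function.comp_apply, Function.comp_apply, fanoutFn_apply, fanoutFn_apply, fanoutFn_apply]
      simp only [Function.comp_apply, hDims, hData, hCand, nthF, fstF_boolPair, sndF_boolPair, consFn_apply,
        List.headD_cons, HashBricks.headBitFn_apply]
  rw [stepOutFn, iteFn_apply hAns]
  by_cases hA : Answers C' (posSet Pb) a v x (steps r)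
  · rw [decide_eq_true hA, if_pos hA]
    simp only [ite_true, Function.comp_apply, fanoutFn_apply, hItem, fstF_boolPair, hCand, bitAtFn_boolPair]
    rw [show (ones ((steps r).1 : ℕ)).length = (steps r).1 by simp [ones], take_one_drop_ofFn _ (steps r).1.isLt]
  · rw [decide_eq_false hA, if_neg hA]
    simp

/-- **The machine decoder is `DirectProduct.decode`.** On the DP record of the trusted-position bits
`Pb`, the trusted tuple `a`, the trusted values `v` and the steps, with an oracle string function
`cand` realising `C'`, `decodeFn cand ⟨D, x⟩ = [decode C' (posSet Pb) a v false steps x]`.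
[cite: CarmosinoImpagliazzoKabanetsKolokolova2016, Thm. 4.1; ImpagliazzoEtAl2010, Algorithm 1] -/
theorem decodeFn_apply {t : ℕ} (C' : (Fin k → (Fin n → Bool)) → Fin k → Bool) {cand : List Bool → List Bool} {G : List Bool}
    (hG : ∀ xs, cand (boolPair G (tupleBits xs)) = List.ofFn (C' xs)) (Pb : Fin k → Bool) (a : Fin k → (Fin n → Bool))
    (v : Fin k → Bool) (steps : Fin t → Fin k × (Fin k → (Fin n → Bool))) (x : Fin n → Bool) :
    decodeFn cand (boolPair (dpRec G n k t (List.ofFn Pb) (tupleBits a) (List.ofFn v) (stepsCode steps)) (List.ofFn x)) =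
      [decode C' (posSet Pb) a v false steps x] := by
  classical
  rw [decodeFn_apply_str, decode, decodeList_eq_headD, List.map_ofFn, flatten_ofFn_eq_ccat]
  congr 2
  refine ccat_congr fun r hr => ?_
  rw [dif_pos hr, stepOutFn_apply C' hG Pb a v steps x ⟨r, hr⟩]
  rfl

end Literature.Computability.Learning
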